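import Literature.Computability.AlgebraicComplexity.MW21SingularTuplesNullCone
import Mathlib.LinearAlgebra.Matrix.ToLinearEquiv
import Mathlib.Algebra.Polynomial.Inductions
import Mathlib.Algebra.Polynomial.Roots
import HarnessLib

/-!
# `SING_{n,m}` versus `NSING_{n,m}` (Makam–Wigderson 2021, §10.2): discharge of
# `makamWigderson2021_sec10_properSubset`

Sibling proof file of `Literature/Computability/AlgebraicComplexity/MW21SingularTuplesNullCone.lean`
(cell `val-lit`, cross-ladder typing row X3-MW21), discharging its named fact
`Literature.Computability.AlgebraicComplexity.makamWigderson2021_sec10_properSubset`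
(V. Makam, A. Wigderson, *Singular tuples of matrices is not a null cone (and the symmetries of
algebraic varieties)*, J. reine angew. Math. **780** (2021) = arXiv:1909.00857, §10.2, held text
`paper:arxiv-1909.00857` p0027): "`NSING_{n,m}` is a proper subset of `SING_{n,m}` precisely when
`n, m ≥ 3`", typed as the conjunction of

1. `∀ n m, n ≤ 2 ∨ m ≤ 2 → SING n m = NSING n m`;
2. `skewTriple ∉ NSING 3 3` (the tree's `skewTriple_not_mem_NSING`, x3 g0);
3. `∀ n m, 3 ≤ n → 3 ≤ m → NSING n m ⊂ SING n m`.

Honest framing: a discharge of a typed published statement; nothing here bears on VP versus VNP.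

## Proofs

`NSING ⊆ SING` is the tree's `NSING_subset_SING`; everything below is the converse inclusion for
small `n` or `m` (the statement "commutative rank = non-commutative rank for `n ≤ 2` or `m ≤ 2`"
that the source cites from Fortin–Reutenauer [FR] and Derksen–Makam [DM]) and the padded
`𝔰𝔬₃` example for large `n, m` ("this example can be modified in straightforward ways", p0027).

* `n = 0`: both sets are empty (`det` of the empty matrix is `1`); `m = 0`, `n ≥ 1`: both sets are
  everything (tree, `mem_NSING_of_m_eq_zero`).
* `n = 1`: a singular `1 × 1` pencil is the zero tuple.
* `m = 1`: a single singular matrix has a kernel vector `k ≠ 0`; `span{k} ↦ 0` is a shrunk subspace.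
* `n = 2` (spaces of `2 × 2` matrices of rank `≤ 1`): move a nonzero member to `E₁₁` by the
  `GL₂ × GL₂` action (which preserves both sets, tree `tripleAct_mem_SING` / `ncRank_range_tripleAct`);
  the vanishing of `det(E₁₁ + Y)`, `det Y`, `det(Y + Y')` for all members forces either all second
  columns or all second rows to vanish, i.e. a common kernel vector or a common image line — a Hall
  blocker in the sense of the tree's `ncRank_lt_of_blocker`.
* `m = 2` (Kronecker's minimal indices, Gantmacher, *Theory of Matrices* II, Ch. XII §3, Thm. 4): if
  `det(A + tB) ≡ 0` then `A + tB` has a nonzero polynomial kernel vector `v(t) = ∑_{j ≤ ε} v_j t^j`;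
  choose one of minimal degree `ε`. Then `A v_0 = 0`, `A v_j = -B v_{j-1}`, `B v_ε = 0`, and
  minimality makes `v_0, …, v_ε` linearly independent (if `∑ λ_j v_j = 0`, the combination
  `∑ λ_h v^{(h)}` of the tails `v^{(h)}(t) = ∑_{j ≥ h} v_j t^{j-h}`, corrected by `λ_0 v`, is a kernel
  vector of smaller degree). Hence `U = span{v_j}` (dimension `ε + 1`) is mapped by `A` and `B`
  into `span{B v_0, …, B v_{ε-1}}` (dimension `≤ ε`): a shrunk subspace, `ncrk < n`.
* `n, m ≥ 3`: the tuple `(S₁ ⊕ I_{n-3}, S₂ ⊕ 0, S₃ ⊕ 0, 0, …, 0)` built from the tree's `skewTriple`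
  `S` lies in `SING` (block determinant) and not in `NSING`: the square `2`-blow-up member
  `∑ᵢ X'ᵢ ⊗ Tᵢ = (∑ Sᵢ ⊗ Tᵢ) ⊕ (I ⊗ T₁)` is invertible (the tree's certificate `certM · certN = 1`
  and `T₁² = 1`), so `ncrk = n` by `ncRank_eq_card_of_mem_blowUp` ([DM18, Cor. 4.7]).

Everything is proved; no named facts, no `instance`, no `notation`; private `def`s are plumbing
(the padded tuple and its certificate).

## References

* [MakamWigderson2021] V. Makam, A. Wigderson, J. reine angew. Math. 780 (2021) 79–131 =
  arXiv:1909.00857, §10.2 (p0027).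
* F. R. Gantmacher, *The Theory of Matrices*, vol. II, Ch. XII §3 (minimal indices of a singular
  pencil), Thm. 4.
* M. Fortin, C. Reutenauer, *Commutative/noncommutative rank of linear matrices and subspaces of
  matrices of low rank*, Sém. Lothar. Combin. 52 (2004) (MW's [FR]).
* H. Derksen, V. Makam, *On non-commutative rank and tensor rank*, Linear Multilinear Algebra 66
  (2018) (MW's [DM-ncrk]; Cor. 4.7 = the tree's `ncRank_eq_card_of_mem_blowUp`).
-/

noncomputable section

open Matrix

namespace Literature.Computability.AlgebraicComplexity

namespace MakamWigderson

variable {n m : ℕ}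

/-! ### Generic helpers on pencils -/

/-- `∑ᵢ δ_{ip} Xᵢ = X_p`. [folklore] -/
private theorem sum_single_smul (X : Tuple n m) (p : Fin m) :
    ∑ i, (Pi.single p (1 : ℂ) : Fin m → ℂ) i • X i = X p := by
  rw [Finset.sum_eq_single p]
  · rw [Pi.single_eq_same, one_smul]
  · intro i _ hip
    rw [Pi.single_eq_of_ne hip, zero_smul]
  · intro h
    exact absurd (Finset.mem_univ p) h

/-- Every member `X_p` of a tuple in `SING` is singular. [cite: MakamWigderson2021, §1.2 (1)] -/
theorem det_apply_eq_zero_of_mem_SING {X : Tuple n m} (hX : X ∈ SING n m) (p : Fin m) :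
    (X p).det = 0 := by
  rw [mem_SING_iff_forall_det_eq_zero] at hX
  have h := hX (Pi.single p 1)
  rwa [sum_single_smul] at h

/-- For a tuple in `SING`, `det(X_p + X_q) = 0`. [cite: MakamWigderson2021, §1.2 (1)] -/
theorem det_add_eq_zero_of_mem_SING {X : Tuple n m} (hX : X ∈ SING n m) (p q : Fin m) :
    (X p + X q).det = 0 := by
  rw [mem_SING_iff_forall_det_eq_zero] at hX
  have h := hX (Pi.single p 1 + Pi.single q 1)
  have hsum : ∑ i, (Pi.single p (1 : ℂ) + Pi.single q 1 : Fin m → ℂ) i • X i = X p + X q := by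
    simp only [Pi.add_apply, add_smul, Finset.sum_add_distrib, sum_single_smul]
  rwa [hsum] at h

/-- For a tuple in `SING`, `det(X_p + s • X_q) = 0`. [cite: MakamWigderson2021, §1.2 (1)] -/
theorem det_add_smul_eq_zero_of_mem_SING {X : Tuple n m} (hX : X ∈ SING n m) (p q : Fin m)
    (s : ℂ) : (X p + s • X q).det = 0 := by
  rw [mem_SING_iff_forall_det_eq_zero] at hX
  have h := hX (Pi.single p 1 + s • Pi.single q 1)
  have hsum : ∑ i, (Pi.single p (1 : ℂ) + s • Pi.single q 1 : Fin m → ℂ) i • X i =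
      X p + s • X q := by
    simp only [Pi.add_apply, Pi.smul_apply, smul_eq_mul, add_smul, Finset.sum_add_distrib,
      sum_single_smul, mul_smul, ← Finset.smul_sum]
  rwa [hsum] at h

/-- `SING = NSING` as soon as `SING ⊆ NSING` (the other inclusion is the tree's
`NSING_subset_SING`). [cite: MakamWigderson2021, §10.2 (p0027)] -/
theorem SING_eq_NSING_of_subset (h : SING n m ⊆ NSING n m) : SING n m = NSING n m :=
  Set.Subset.antisymm h NSING_subset_SING

/-! ### Degenerate sizes `n = 0`, `m = 0`, and the cases `n = 1`, `m = 1` -/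

/-- `SING_{0,m} = ∅` (the determinant of the empty matrix is `1`).
[cite: MakamWigderson2021, §1.2 (1)] -/
theorem SING_zero_eq_empty (m : ℕ) : SING 0 m = ∅ := by
  ext X
  simp only [Set.mem_empty_iff_false, iff_false]
  intro h
  rw [mem_SING_iff, Matrix.det_isEmpty] at h
  exact one_ne_zero h

/-- `NSING_{0,m} = ∅` (`ncrk < 0` is impossible). [cite: MakamWigderson2021, §1.2 (NSING)] -/
theorem NSING_zero_eq_empty (m : ℕ) : NSING 0 m = ∅ := by
  ext X
  simp only [Set.mem_empty_iff_false, iff_false]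
  intro h
  rw [mem_NSING_iff] at h
  exact Nat.not_lt_zero _ h

/-- `SING_{0,m} = NSING_{0,m}` (both empty). [cite: MakamWigderson2021, §10.2 (p0027)] -/
theorem SING_eq_NSING_zero (m : ℕ) : SING 0 m = NSING 0 m := by
  rw [SING_zero_eq_empty, NSING_zero_eq_empty]

/-- `SING_{n,0} = NSING_{n,0}`. [cite: MakamWigderson2021, §10.2 (p0027)] -/
theorem SING_eq_NSING_of_m_eq_zero (n : ℕ) : SING n 0 = NSING n 0 := by
  rcases Nat.eq_zero_or_pos n with rfl | hn
  · exact SING_eq_NSING_zero 0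
  · exact SING_eq_NSING_of_subset fun X _ => mem_NSING_of_m_eq_zero hn X

/-- `SING_{1,m} ⊆ NSING_{1,m}`: a singular `1 × 1` pencil is the zero tuple, whose matrix space
has non-commutative rank `0`. [cite: MakamWigderson2021, §10.2 (p0027)] -/
theorem SING_one_subset_NSING (m : ℕ) : SING 1 m ⊆ NSING 1 m := by
  intro X hX
  have hzero : ∀ l (j k : Fin 1), X l j k = 0 := by
    intro l j k
    have h := det_apply_eq_zero_of_mem_SING hX l
    rw [Matrix.det_unique] at h
    rw [Subsingleton.elim j default, Subsingleton.elim k default]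
    exact h
  rw [mem_NSING_iff]
  refine ncRank_lt_of_blocker X (A := Finset.univ) (N := ∅)
    (fun l j k _ hne => absurd (hzero l j k) hne) ?_
  simp

/-- `SING_{n,1} ⊆ NSING_{n,1}`: a singular matrix `X₁` has a kernel vector `k ≠ 0`, and
`span{k} ↦ 0` is a `1`-shrunk subspace. [cite: MakamWigderson2021, §10.2 (p0027)] -/
theorem SING_subset_NSING_of_m_eq_one (n : ℕ) : SING n 1 ⊆ NSING n 1 := by
  intro X hX
  have hdet : (X 0).det = 0 := det_apply_eq_zero_of_mem_SING hX 0
  obtain ⟨k, hk0, hk⟩ := Matrix.exists_mulVec_eq_zero_iff.mpr hdet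
  rw [mem_NSING_iff]
  let W : Submodule ℂ (Fin n → ℂ) := Submodule.span ℂ {k}
  have hcover : ∀ B ∈ Set.range X, W.map B.mulVecLin ≤ (⊥ : Submodule ℂ (Fin n → ℂ)) := by
    rintro _ ⟨l, rfl⟩
    obtain rfl : l = 0 := Subsingleton.elim l 0
    rw [Submodule.map_le_iff_le_comap, Submodule.span_le]
    intro x hx
    rw [Set.mem_singleton_iff] at hx
    subst hx
    rw [SetLike.mem_coe, Submodule.mem_comap, Matrix.mulVecLin_apply, hk]
    exact Submodule.zero_mem _
  have hle := ncRank_le_of_cover (Set.range X) ⊥ W hcover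
  have hW : Module.finrank ℂ W = 1 := finrank_span_singleton hk0
  have hq := Submodule.finrank_quotient_add_finrank W
  rw [Module.finrank_fintype_fun_eq_card, Fintype.card_fin] at hq
  rw [finrank_bot] at hle
  omega

/-! ### `n = 2`: spaces of `2 × 2` matrices of rank `≤ 1` -/

/-- Normal form of a rank-one `2 × 2` matrix whose `(0,0)` entry is nonzero: `Q A Cᵀ = E₁₁` for
explicit invertible `Q`, `C` (one row and one column operation). [folklore] -/
private theorem exists_normalize_of_entry_ne_zero (A : Matrix (Fin 2) (Fin 2) ℂ) (hA : A 0 0 ≠ 0)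
    (hdet : A.det = 0) :
    ∃ Q C : GL (Fin 2) ℂ, (Q : Matrix (Fin 2) (Fin 2) ℂ) * A * (C : Matrix (Fin 2) (Fin 2) ℂ)ᵀ =
      !![1, 0; 0, 0] := by
  rw [Matrix.det_fin_two] at hdet
  have h11 : A 1 1 = A 0 1 * A 1 0 * (A 0 0)⁻¹ := by
    field_simp
    linear_combination hdet
  have hQdet : Matrix.det (!![1, 0; -(A 1 0) * (A 0 0)⁻¹, 1] : Matrix (Fin 2) (Fin 2) ℂ) ≠ 0 := by
    rw [Matrix.det_fin_two_of]; simp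
  have hCdet : Matrix.det (!![(A 0 0)⁻¹, 0; -(A 0 1) * (A 0 0)⁻¹, 1] : Matrix (Fin 2) (Fin 2) ℂ) ≠ 0 := by
    rw [Matrix.det_fin_two_of]; simp [hA]
  refine ⟨Matrix.GeneralLinearGroup.mkOfDetNeZero _ hQdet,
    Matrix.GeneralLinearGroup.mkOfDetNeZero _ hCdet, ?_⟩
  rw [Matrix.GeneralLinearGroup.val_mkOfDetNeZero, Matrix.GeneralLinearGroup.val_mkOfDetNeZero]
  ext i j
  fin_cases i <;> fin_cases j <;>
    simp only [Matrix.mul_apply, Fin.sum_univ_two, Matrix.transpose_apply] <;>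
    simp [h11, hA] <;> field_simp <;> ring

/-- The swap matrix. [folklore] -/
private theorem swap_det_ne_zero : Matrix.det (!![0, 1; 1, 0] : Matrix (Fin 2) (Fin 2) ℂ) ≠ 0 := by
  rw [Matrix.det_fin_two_of]; simp

/-- Some pair of coordinate permutations moves a nonzero entry of `A ≠ 0` to position `(0,0)`.
[folklore] -/
private theorem exists_perm_entry_ne_zero (A : Matrix (Fin 2) (Fin 2) ℂ) (hA : A ≠ 0) :
    ∃ Q C : GL (Fin 2) ℂ,
      ((Q : Matrix (Fin 2) (Fin 2) ℂ) * A * (C : Matrix (Fin 2) (Fin 2) ℂ)ᵀ) 0 0 ≠ 0 := by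
  have hex : ∃ i j, A i j ≠ 0 := by
    by_contra h
    push Not at h
    exact hA (Matrix.ext fun i j => h i j)
  obtain ⟨i, j, hij⟩ := hex
  let S : GL (Fin 2) ℂ := Matrix.GeneralLinearGroup.mkOfDetNeZero _ swap_det_ne_zero
  have hS : (S : Matrix (Fin 2) (Fin 2) ℂ) = !![0, 1; 1, 0] :=
    Matrix.GeneralLinearGroup.val_mkOfDetNeZero _ _
  fin_cases i <;> fin_cases j
  · refine ⟨1, 1, ?_⟩
    simpa using hij
  · refine ⟨1, S, ?_⟩
    rw [hS, Units.val_one, Matrix.one_mul]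
    simp only [Matrix.mul_apply, Fin.sum_univ_two, Matrix.transpose_apply]
    simpa using hij
  · refine ⟨S, 1, ?_⟩
    rw [hS, Units.val_one, Matrix.transpose_one, Matrix.mul_one]
    simp only [Matrix.mul_apply, Fin.sum_univ_two]
    simpa using hij
  · refine ⟨S, S, ?_⟩
    rw [hS]
    simp only [Matrix.mul_apply, Fin.sum_univ_two, Matrix.transpose_apply]
    simpa using hij

/-- **Rank-one normal form**: a nonzero singular `2 × 2` matrix is `GL₂ × GL₂`-equivalent to `E₁₁`.
[folklore] -/
private theorem exists_mul_mul_transpose_eq_e11 (A : Matrix (Fin 2) (Fin 2) ℂ) (hA : A ≠ 0)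
    (hdet : A.det = 0) :
    ∃ Q C : GL (Fin 2) ℂ, (Q : Matrix (Fin 2) (Fin 2) ℂ) * A * (C : Matrix (Fin 2) (Fin 2) ℂ)ᵀ =
      !![1, 0; 0, 0] := by
  obtain ⟨Q₀, C₀, h₀⟩ := exists_perm_entry_ne_zero A hA
  have hdet' : ((Q₀ : Matrix (Fin 2) (Fin 2) ℂ) * A * (C₀ : Matrix (Fin 2) (Fin 2) ℂ)ᵀ).det = 0 := by
    rw [Matrix.det_mul, Matrix.det_mul, hdet, mul_zero, zero_mul]
  obtain ⟨Q₁, C₁, h₁⟩ := exists_normalize_of_entry_ne_zero _ h₀ hdet'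
  refine ⟨Q₁ * Q₀, C₁ * C₀, ?_⟩
  rw [Units.val_mul, Units.val_mul, Matrix.transpose_mul, ← h₁]
  simp only [Matrix.mul_assoc]

/-- In a singular `2 × 2` pencil containing `E₁₁`, either every second column or every second row
vanishes. [cite: MakamWigderson2021, §10.2 (p0027)] -/
theorem col_or_row_eq_zero_of_mem_SING_two {Y : Tuple 2 m} (hY : Y ∈ SING 2 m) {p : Fin m}
    (hp : Y p = !![1, 0; 0, 0]) : (∀ i j, Y i j 1 = 0) ∨ (∀ i k, Y i 1 k = 0) := by
  -- every member has vanishing `(1,1)` entry and determinant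
  have hdet : ∀ i, Y i 0 0 * Y i 1 1 - Y i 0 1 * Y i 1 0 = 0 := fun i => by
    rw [← Matrix.det_fin_two]; exact det_apply_eq_zero_of_mem_SING hY i
  have h11 : ∀ i, Y i 1 1 = 0 := by
    intro i
    by_cases hip : i = p
    · rw [hip, hp]; rfl
    have h := det_add_eq_zero_of_mem_SING hY p i
    rw [Matrix.det_fin_two, hp] at h
    simp [Matrix.add_apply] at h
    -- `h : (1 + Y i 0 0) * Y i 1 1 - Y i 0 1 * Y i 1 0 = 0`
    linear_combination h - hdet i
  have h01 : ∀ i, Y i 0 1 * Y i 1 0 = 0 := fun i => by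
    linear_combination -(hdet i) + Y i 0 0 * h11 i
  by_contra hcon
  rw [not_or] at hcon
  obtain ⟨h1, h2⟩ := hcon
  push Not at h1 h2
  obtain ⟨q, j, hqj⟩ := h1
  obtain ⟨r, k, hrk⟩ := h2
  have hj : j = 0 := by
    fin_cases j
    · rfl
    · exact absurd (h11 q) hqj
  have hk : k = 0 := by
    fin_cases k
    · rfl
    · exact absurd (h11 r) hrk
  subst hj hk
  -- `Y q 0 1 ≠ 0`, `Y r 1 0 ≠ 0`, hence `Y q 1 0 = 0 = Y r 0 1`
  have hq10 : Y q 1 0 = 0 := by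
    rcases mul_eq_zero.mp (h01 q) with h | h
    · exact absurd h hqj
    · exact h
  have hr01 : Y r 0 1 = 0 := by
    rcases mul_eq_zero.mp (h01 r) with h | h
    · exact h
    · exact absurd h hrk
  by_cases hqr : q = r
  · subst hqr
    exact hqj hr01
  have h := det_add_eq_zero_of_mem_SING hY q r
  rw [Matrix.det_fin_two] at h
  simp only [Matrix.add_apply, h11, hq10, hr01, add_zero, zero_add, mul_zero, zero_sub,
    neg_eq_zero] at h
  rcases mul_eq_zero.mp h with h | h
  · exact hqj h
  · exact hrk h

/-- **`SING_{2,m} ⊆ NSING_{2,m}`**: a space of `2 × 2` matrices consisting of singular matrices has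
a common kernel vector or a common image line ([FR]; the tree's Hall blocker after normalising a
nonzero member to `E₁₁`). [cite: MakamWigderson2021, §10.2 (p0027)] -/
theorem SING_two_subset_NSING (m : ℕ) : SING 2 m ⊆ NSING 2 m := by
  intro X hX
  by_cases hall : ∀ i, X i = 0
  · rw [mem_NSING_iff]
    refine ncRank_lt_of_blocker X (A := Finset.univ) (N := ∅) (fun l j k _ hne => ?_) (by simp)
    exact absurd (by rw [hall l]; rfl) hne
  push Not at hall
  obtain ⟨p, hp⟩ := hall
  obtain ⟨Q, C, hQC⟩ := exists_mul_mul_transpose_eq_e11 (X p) hp (det_apply_eq_zero_of_mem_SING hX p)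
  -- the transformed tuple `Y = (1, Q, C)·X`, `Yᵢ = Q Xᵢ Cᵀ`
  set Y : Tuple 2 m := tripleAct ((1 : GL (Fin m) ℂ) : Matrix (Fin m) (Fin m) ℂ)
    (Q : Matrix (Fin 2) (Fin 2) ℂ) (C : Matrix (Fin 2) (Fin 2) ℂ) X with hYdef
  have hYi : ∀ i, Y i = (Q : Matrix (Fin 2) (Fin 2) ℂ) * X i * (C : Matrix (Fin 2) (Fin 2) ℂ)ᵀ := by
    intro i
    rw [hYdef, tripleAct_apply_eq_sum, Units.val_one, Finset.sum_eq_single i]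
    · rw [Matrix.one_apply_eq, one_smul]
    · intro j _ hji
      rw [Matrix.one_apply_ne (Ne.symm hji), zero_smul]
    · intro h
      exact absurd (Finset.mem_univ i) h
  have hY : Y ∈ SING 2 m := by rw [hYdef]; exact tripleAct_mem_SING hX
  have hYp : Y p = !![1, 0; 0, 0] := by rw [hYi, hQC]
  have hncY : ncRank (Set.range Y) < 2 := by
    rcases col_or_row_eq_zero_of_mem_SING_two hY hYp with hcol | hrow
    · refine ncRank_lt_of_blocker Y (A := {1}) (N := ∅) (fun l j k hk hne => ?_) (by simp)
      rw [Finset.mem_singleton] at hk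
      subst hk
      exact absurd (hcol l j) hne
    · refine ncRank_lt_of_blocker Y (A := Finset.univ) (N := {0}) (fun l j k _ hne => ?_) (by simp)
      rw [Finset.mem_singleton]
      fin_cases j
      · rfl
      · exact absurd (hrow l k) hne
  rw [mem_NSING_iff, ← ncRank_range_tripleAct 1 Q C X]
  exact hncY

/-- `SING_{2,m} = NSING_{2,m}`. [cite: MakamWigderson2021, §10.2 (p0027)] -/
theorem SING_eq_NSING_two (m : ℕ) : SING 2 m = NSING 2 m :=
  SING_eq_NSING_of_subset (SING_two_subset_NSING m)

/-! ### `m = 2`: Kronecker's minimal-index argument -/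

/-- The pencil `A + t B` over `ℂ[t]` (private plumbing). [folklore] -/
private def pencil₂ (A B : Matrix (Fin n) (Fin n) ℂ) : Matrix (Fin n) (Fin n) (Polynomial ℂ) :=
  A.map Polynomial.C + (Polynomial.X : Polynomial ℂ) • B.map Polynomial.C

/-- The vector of `j`-th coefficients of a polynomial vector (private plumbing). [folklore] -/
private def coeffVec (v : Fin n → Polynomial ℂ) (j : ℕ) : Fin n → ℂ := fun i => (v i).coeff j

/-- Evaluating the pencil `A + tB` at `t = s`. [folklore] -/
private theorem pencil₂_map_eval (A B : Matrix (Fin n) (Fin n) ℂ) (s : ℂ) :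
    (pencil₂ A B).map (Polynomial.eval s) = A + s • B := by
  ext i j
  simp only [pencil₂, Matrix.map_apply, Matrix.add_apply, Matrix.smul_apply, smul_eq_mul,
    Polynomial.eval_add, Polynomial.eval_mul, Polynomial.eval_C, Polynomial.eval_X]

/-- `det(A + tB) = 0` in `ℂ[t]` when `det(A + sB) = 0` for every `s ∈ ℂ`. [folklore] -/
private theorem det_pencil₂_eq_zero {A B : Matrix (Fin n) (Fin n) ℂ}
    (h : ∀ s : ℂ, (A + s • B).det = 0) : (pencil₂ A B).det = 0 := by
  apply Polynomial.funext
  intro s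
  have hdet := RingHom.map_det (Polynomial.evalRingHom s) (pencil₂ A B)
  rw [RingHom.mapMatrix_apply, Polynomial.coe_evalRingHom, pencil₂_map_eval] at hdet
  rw [hdet, h s, Polynomial.eval_zero]

/-- Coefficients of `(A ⊗ 1) v` for a constant matrix `A`. [folklore] -/
private theorem coeff_map_C_mulVec (A : Matrix (Fin n) (Fin n) ℂ) (v : Fin n → Polynomial ℂ)
    (i : Fin n) (j : ℕ) : ((A.map Polynomial.C *ᵥ v) i).coeff j = (A *ᵥ coeffVec v j) i := by
  simp only [Matrix.mulVec, dotProduct, Matrix.map_apply, Polynomial.finsetSum_coeff,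
    Polynomial.coeff_C_mul, coeffVec]

/-- The constant coefficient of `(A + tB) v`. [folklore] -/
private theorem coeff_pencil₂_mulVec_zero (A B : Matrix (Fin n) (Fin n) ℂ)
    (v : Fin n → Polynomial ℂ) (i : Fin n) :
    ((pencil₂ A B *ᵥ v) i).coeff 0 = (A *ᵥ coeffVec v 0) i := by
  rw [pencil₂, Matrix.add_mulVec, Matrix.smul_mulVec, Pi.add_apply, Pi.smul_apply,
    Polynomial.coeff_add, coeff_map_C_mulVec, smul_eq_mul, Polynomial.coeff_X_mul_zero, add_zero]

/-- The coefficient of `t^{j+1}` in `(A + tB) v`. [folklore] -/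
private theorem coeff_pencil₂_mulVec_succ (A B : Matrix (Fin n) (Fin n) ℂ)
    (v : Fin n → Polynomial ℂ) (i : Fin n) (j : ℕ) :
    ((pencil₂ A B *ᵥ v) i).coeff (j + 1) =
      (A *ᵥ coeffVec v (j + 1)) i + (B *ᵥ coeffVec v j) i := by
  rw [pencil₂, Matrix.add_mulVec, Matrix.smul_mulVec, Pi.add_apply, Pi.smul_apply,
    Polynomial.coeff_add, coeff_map_C_mulVec, smul_eq_mul, Polynomial.coeff_X_mul,
    coeff_map_C_mulVec]

/-- `(A + tB) v = 0` iff `A v_0 = 0` and `A v_{j+1} + B v_j = 0` for all `j` (`v_j` = coefficient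
vectors). [folklore] -/
private theorem pencil₂_mulVec_eq_zero_iff (A B : Matrix (Fin n) (Fin n) ℂ)
    (v : Fin n → Polynomial ℂ) :
    pencil₂ A B *ᵥ v = 0 ↔
      A *ᵥ coeffVec v 0 = 0 ∧ ∀ j, A *ᵥ coeffVec v (j + 1) + B *ᵥ coeffVec v j = 0 := by
  constructor
  · intro h
    refine ⟨funext fun i => ?_, fun j => funext fun i => ?_⟩
    · rw [← coeff_pencil₂_mulVec_zero, h]; rfl
    · rw [Pi.add_apply, ← coeff_pencil₂_mulVec_succ, h]; rfl
  · rintro ⟨h0, hs⟩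
    funext i
    refine Polynomial.ext fun j => ?_
    rcases j with _ | j
    · rw [coeff_pencil₂_mulVec_zero, h0]; rfl
    · rw [coeff_pencil₂_mulVec_succ, ← Pi.add_apply (A *ᵥ _), hs j]; rfl

/-- Coefficients of the iterated shift `p ↦ (p - p(0))/t`. [folklore] -/
private theorem coeff_iterate_divX (p : Polynomial ℂ) (h j : ℕ) :
    (Polynomial.divX^[h] p).coeff j = p.coeff (j + h) := by
  induction h generalizing p with
  | zero => rw [Function.iterate_zero_apply, Nat.add_zero]
  | succ h ih =>
    rw [Function.iterate_succ_apply, ih, Polynomial.coeff_divX, Nat.add_assoc]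

/-- **Singular pencils of two matrices have a shrunk subspace** (Kronecker; Gantmacher XII §3
Thm. 4): if `det(A + sB) = 0` for every `s ∈ ℂ` then `ncrk{A, B} < n` — the coefficient vectors
`v_0, …, v_ε` of a minimal-degree polynomial kernel vector of `A + tB` are linearly independent and
span a subspace mapped by `A` and `B` into `span{B v_0, …, B v_{ε-1}}`.
[cite: MakamWigderson2021, §10.2 (p0027)] -/
theorem ncRank_pair_lt_of_det_add_smul_eq_zero {A B : Matrix (Fin n) (Fin n) ℂ}
    (hAB : ∀ s : ℂ, (A + s • B).det = 0) :
    ncRank ({A, B} : Set (Matrix (Fin n) (Fin n) ℂ)) < n := by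
  classical
  -- a nonzero polynomial kernel vector, of minimal degree `ε`
  obtain ⟨v₀, hv₀0, hv₀⟩ := Matrix.exists_mulVec_eq_zero_iff.mpr (det_pencil₂_eq_zero hAB)
  let P : ℕ → Prop := fun d =>
    ∃ w : Fin n → Polynomial ℂ, w ≠ 0 ∧ pencil₂ A B *ᵥ w = 0 ∧ ∀ i, (w i).natDegree ≤ d
  have hP : ∃ d, P d :=
    ⟨Finset.univ.sup fun i => (v₀ i).natDegree, v₀, hv₀0, hv₀,
      fun i => Finset.le_sup (f := fun i => (v₀ i).natDegree) (Finset.mem_univ i)⟩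
  obtain ⟨v, hv0, hv, hdeg⟩ : P (Nat.find hP) := Nat.find_spec hP
  have hmin : ∀ d < Nat.find hP, ¬ P d := fun d hd => Nat.find_min hP hd
  set ε : ℕ := Nat.find hP with hεdef
  obtain ⟨hA0, hrel⟩ := (pencil₂_mulVec_eq_zero_iff A B v).mp hv
  -- coefficient vectors `c j = v_j`, zero above `ε`
  set c : ℕ → (Fin n → ℂ) := coeffVec v with hcdef
  have hcvan : ∀ j, ε < j → c j = 0 := fun j hj =>
    funext fun i => Polynomial.coeff_eq_zero_of_natDegree_lt ((hdeg i).trans_lt hj)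
  have hBε : B *ᵥ c ε = 0 := by
    have h := hrel ε
    rwa [hcvan (ε + 1) (Nat.lt_succ_self ε), Matrix.mulVec_zero, zero_add] at h
  have hcε : c ε ≠ 0 := by
    intro hzero
    rcases Nat.eq_zero_or_pos ε with hε0 | hεpos
    · apply hv0
      funext i
      have hdi : (v i).natDegree ≤ 0 := by rw [← hε0]; exact hdeg i
      have hci : (v i).coeff 0 = 0 := by
        have h := congrFun hzero i
        rw [hε0] at h
        exact h
      rw [Polynomial.eq_C_of_natDegree_le_zero hdi, hci, map_zero, Pi.zero_apply]
    · refine hmin (ε - 1) (by omega) ⟨v, hv0, hv, fun i => ?_⟩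
      rw [Polynomial.natDegree_le_iff_coeff_eq_zero]
      intro N hN
      rcases (show N = ε ∨ ε < N by omega) with rfl | hlt
      · exact congrFun hzero i
      · exact Polynomial.coeff_eq_zero_of_natDegree_lt ((hdeg i).trans_lt hlt)
  -- the shift trick: a combination of tails `∑ₕ μₕ v^{(h)}` vanishing below `h₁ ≥ 1`, with
  -- `A (∑ₕ μₕ v_h) = 0`, is a kernel vector of degree `≤ ε - h₁`, nonzero if `μ_{h₁} ≠ 0`
  have hsmall : ∀ (μ : ℕ → ℂ) (h₁ : ℕ), 1 ≤ h₁ → h₁ ≤ ε → (∀ h, h < h₁ → μ h = 0) → μ h₁ ≠ 0 →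
      A *ᵥ (∑ h ∈ Finset.range (ε + 1), μ h • c h) = 0 → False := by
    intro μ h₁ h1 hle hlow hμ hker
    let w : Fin n → Polynomial ℂ := fun i =>
      ∑ h ∈ Finset.range (ε + 1), μ h • (Polynomial.divX^[h] (v i))
    have hcoeff : ∀ j, coeffVec w j = ∑ h ∈ Finset.range (ε + 1), μ h • c (j + h) := by
      intro j
      funext i
      simp only [coeffVec, w, Polynomial.finsetSum_coeff, Polynomial.coeff_smul,
        coeff_iterate_divX, Finset.sum_apply, Pi.smul_apply, hcdef]
    have hwsol : pencil₂ A B *ᵥ w = 0 := by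
      rw [pencil₂_mulVec_eq_zero_iff]
      refine ⟨?_, fun j => ?_⟩
      · rw [hcoeff]
        simpa only [zero_add] using hker
      · rw [hcoeff, hcoeff, Matrix.mulVec_sum, Matrix.mulVec_sum, ← Finset.sum_add_distrib]
        refine Finset.sum_eq_zero fun h _ => ?_
        rw [Matrix.mulVec_smul, Matrix.mulVec_smul, ← smul_add,
          show j + 1 + h = j + h + 1 by omega, hrel (j + h), smul_zero]
    have hwdeg : ∀ i, (w i).natDegree ≤ ε - h₁ := by
      intro i
      rw [Polynomial.natDegree_le_iff_coeff_eq_zero]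
      intro N hN
      have hci := congrFun (hcoeff N) i
      simp only [coeffVec] at hci
      rw [hci, Finset.sum_apply]
      refine Finset.sum_eq_zero fun h _ => ?_
      by_cases hlt : h < h₁
      · rw [hlow h hlt, zero_smul, Pi.zero_apply]
      · rw [hcvan _ (by omega), smul_zero, Pi.zero_apply]
    have hwne : w ≠ 0 := by
      intro hw
      have hc := hcoeff (ε - h₁)
      have hsum : ∑ h ∈ Finset.range (ε + 1), μ h • c (ε - h₁ + h) = μ h₁ • c ε := by
        rw [Finset.sum_eq_single h₁]
        · rw [show ε - h₁ + h₁ = ε by omega]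
        · intro h _ hne
          by_cases hlt : h < h₁
          · rw [hlow h hlt, zero_smul]
          · rw [hcvan _ (by omega), smul_zero]
        · intro hh
          exact absurd (Finset.mem_range.mpr (by omega)) hh
      rw [hsum, hw] at hc
      have hzero : μ h₁ • c ε = 0 := by
        rw [← hc]
        funext i
        simp [coeffVec]
      exact hcε ((smul_eq_zero.mp hzero).resolve_left hμ)
    exact hmin (ε - h₁) (by omega) ⟨w, hwne, hwsol, hwdeg⟩
  -- linear independence of `v_0, …, v_ε`
  have hli : LinearIndependent ℂ (fun h : Fin (ε + 1) => c h) := by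
    rw [Fintype.linearIndependent_iff]
    intro g hg
    let μ : ℕ → ℂ := fun h => if hh : h < ε + 1 then g ⟨h, hh⟩ else 0
    have hμg : ∀ h : Fin (ε + 1), μ h = g h := fun h => by
      simp only [μ, h.2, dif_pos]
    have hμsum : ∑ h ∈ Finset.range (ε + 1), μ h • c h = 0 := by
      rw [Finset.sum_range (fun h => μ h • c h), ← hg]
      exact Finset.sum_congr rfl fun h _ => by rw [hμg]
    by_contra hne
    push Not at hne
    obtain ⟨i₀, hi₀⟩ := hne
    by_cases hex : ∃ h, 1 ≤ h ∧ h ≤ ε ∧ μ h ≠ 0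
    · obtain ⟨h1, hle, hμ⟩ := Nat.find_spec hex
      have hlow' : ∀ h, h < Nat.find hex → 1 ≤ h → μ h = 0 := fun h hlt h1' => by
        by_contra hμh
        exact Nat.find_min hex hlt ⟨h1', by omega, hμh⟩
      let μ' : ℕ → ℂ := fun h => if h = 0 then 0 else μ h
      refine hsmall μ' (Nat.find hex) h1 hle (fun h hlt => ?_) ?_ ?_
      · by_cases hz : h = 0
        · simp only [μ', hz, if_true]
        · simp only [μ', hz, if_false]
          exact hlow' h hlt (by omega)
      · simp only [μ', show Nat.find hex ≠ 0 by omega, if_false]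
        exact hμ
      · have hsum' : ∑ h ∈ Finset.range (ε + 1), μ' h • c h = -(μ 0 • c 0) := by
          rw [eq_neg_iff_add_eq_zero, ← hμsum, Finset.sum_range_succ' (fun h => μ' h • c h),
            Finset.sum_range_succ' (fun h => μ h • c h)]
          simp only [μ', Nat.succ_ne_zero, if_false, if_true, zero_smul, add_zero]
        rw [hsum', Matrix.mulVec_neg, Matrix.mulVec_smul, hA0, smul_zero, neg_zero]
    · push Not at hex
      have hμ0 : μ 0 ≠ 0 := by
        intro h0
        apply hi₀
        rw [← hμg i₀]
        rcases Nat.eq_zero_or_pos (i₀ : ℕ) with hz | hpos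
        · rw [hz, h0]
        · exact hex _ hpos (by omega)
      have hc0 : c 0 = 0 := by
        have h : μ 0 • c 0 = 0 := by
          rw [← hμsum, Finset.sum_range_succ' (fun h => μ h • c h)]
          rw [Finset.sum_eq_zero fun h hh => ?_, zero_add]
          rw [hex (h + 1) (by omega) (by have := Finset.mem_range.mp hh; omega), zero_smul]
        exact (smul_eq_zero.mp h).resolve_left hμ0
      have hε1 : 1 ≤ ε := by
        by_contra h
        have hε0 : ε = 0 := by omega
        apply hcε
        rw [hε0]
        exact hc0
      refine hsmall (fun h => if h = 1 then 1 else 0) 1 le_rfl hε1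
        (fun h hlt => by simp only [show h ≠ 1 by omega, if_false]) (by simp) ?_
      have hsum1 : ∑ h ∈ Finset.range (ε + 1), (if h = 1 then (1 : ℂ) else 0) • c h = c 1 := by
        rw [Finset.sum_eq_single 1]
        · rw [if_pos rfl, one_smul]
        · intro h _ hne
          rw [if_neg hne, zero_smul]
        · intro hh
          exact absurd (Finset.mem_range.mpr (by omega)) hh
      rw [hsum1]
      have h := hrel 0
      rwa [zero_add, hc0, Matrix.mulVec_zero, add_zero] at h
  -- the shrunk subspace `U = span{v_0, …, v_ε} ↦ W = span{B v_0, …, B v_{ε-1}}`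
  let U : Submodule ℂ (Fin n → ℂ) := Submodule.span ℂ (Set.range fun h : Fin (ε + 1) => c h)
  let W : Submodule ℂ (Fin n → ℂ) :=
    Submodule.span ℂ (((Finset.range ε).image fun h => B *ᵥ c h : Finset (Fin n → ℂ)) :
      Set (Fin n → ℂ))
  have hU : Module.finrank ℂ U = ε + 1 := by
    show Module.finrank ℂ (Submodule.span ℂ (Set.range fun h : Fin (ε + 1) => c h)) = ε + 1
    rw [finrank_span_eq_card hli, Fintype.card_fin]
  have hW : Module.finrank ℂ W ≤ ε :=
    (finrank_span_finset_le_card _).trans (Finset.card_image_le.trans (Finset.card_range ε).le)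
  have hBW : ∀ h, h < ε → B *ᵥ c h ∈ W := fun h hh =>
    Submodule.subset_span (Finset.mem_coe.mpr (Finset.mem_image.mpr ⟨h, Finset.mem_range.mpr hh, rfl⟩))
  have hAW : ∀ h, A *ᵥ c h ∈ W := by
    intro h
    rcases Nat.eq_zero_or_pos h with rfl | hpos
    · rw [hA0]; exact W.zero_mem
    · obtain ⟨k, rfl⟩ : ∃ k, h = k + 1 := ⟨h - 1, by omega⟩
      rcases (show k < ε ∨ ε ≤ k by omega) with hk | hk
      · have h2 := hrel k
        rw [add_eq_zero_iff_eq_neg] at h2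
        rw [h2]
        exact W.neg_mem (hBW k hk)
      · rw [hcvan (k + 1) (by omega), Matrix.mulVec_zero]
        exact W.zero_mem
  have hBW' : ∀ h, B *ᵥ c h ∈ W := by
    intro h
    rcases (show h < ε ∨ h = ε ∨ ε < h by omega) with hlt | rfl | hgt
    · exact hBW h hlt
    · rw [hBε]; exact W.zero_mem
    · rw [hcvan h hgt, Matrix.mulVec_zero]; exact W.zero_mem
  have hcover : ∀ M ∈ ({A, B} : Set (Matrix (Fin n) (Fin n) ℂ)), U.map M.mulVecLin ≤ W := by
    intro M hM
    rw [Submodule.map_span_le]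
    rintro _ ⟨h, rfl⟩
    rw [Matrix.mulVecLin_apply]
    rcases hM with rfl | hM
    · exact hAW h
    · rw [Set.mem_singleton_iff] at hM
      rw [hM]
      exact hBW' h
  have hle := ncRank_le_of_cover ({A, B} : Set (Matrix (Fin n) (Fin n) ℂ)) W U hcover
  have hq := Submodule.finrank_quotient_add_finrank U
  rw [Module.finrank_fintype_fun_eq_card, Fintype.card_fin] at hq
  omega

/-- **`SING_{n,2} ⊆ NSING_{n,2}`** (commutative = non-commutative rank for pencils of two
matrices, [FR]/[DM]; Kronecker). [cite: MakamWigderson2021, §10.2 (p0027)] -/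
theorem SING_subset_NSING_of_m_eq_two (n : ℕ) : SING n 2 ⊆ NSING n 2 := by
  intro X hX
  have hAB : ∀ s : ℂ, (X 0 + s • X 1).det = 0 := fun s =>
    det_add_smul_eq_zero_of_mem_SING hX 0 1 s
  rw [mem_NSING_iff]
  have hrange : Set.range X = {X 0, X 1} := by
    ext M
    simp only [Set.mem_range, Set.mem_insert_iff, Set.mem_singleton_iff]
    constructor
    · rintro ⟨i, rfl⟩
      fin_cases i
      · exact Or.inl rfl
      · exact Or.inr rfl
    · rintro (rfl | rfl)
      exacts [⟨0, rfl⟩, ⟨1, rfl⟩]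
  rw [hrange]
  exact ncRank_pair_lt_of_det_add_smul_eq_zero hAB

/-! ### `n, m ≥ 3`: the padded `𝔰𝔬₃` triple -/

/-- The padded triple `(S₁ ⊕ I_k, S₂ ⊕ 0, S₃ ⊕ 0)` on `ℂ³ ⊕ ℂ^k` (`S = skewTriple`; private
plumbing). [cite: MakamWigderson2021, §10.2 (example, p0027)] -/
private def padS (k : ℕ) (i : Fin 3) : Matrix (Fin 3 ⊕ Fin k) (Fin 3 ⊕ Fin k) ℂ :=
  Matrix.fromBlocks (skewTriple i) 0 0 (if i = 0 then 1 else 0)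

/-- A member `∑ cᵢ X'ᵢ` of the padded space is block diagonal with blocks `∑ cᵢ Sᵢ` and `c₁ I`.
[cite: MakamWigderson2021, §10.2 (example, p0027)] -/
private theorem sum_smul_padS (k : ℕ) (c : Fin 3 → ℂ) :
    ∑ i, c i • padS k i =
      Matrix.fromBlocks (∑ i, c i • skewTriple i) 0 0 (c 0 • (1 : Matrix (Fin k) (Fin k) ℂ)) := by
  ext (a | a) (b | b)
  · simp [padS, Matrix.sum_apply]
  · simp [padS, Matrix.sum_apply]
  · simp [padS, Matrix.sum_apply]
  · simp [padS, Matrix.sum_apply, Fin.sum_univ_three]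

/-- The padded space consists of singular matrices (`det(∑ cᵢSᵢ) = 0`, tree `skewTriple_mem_SING`).
[cite: MakamWigderson2021, §10.2 (example, p0027)] -/
private theorem det_sum_smul_padS (k : ℕ) (c : Fin 3 → ℂ) : (∑ i, c i • padS k i).det = 0 := by
  rw [sum_smul_padS, Matrix.det_fromBlocks_zero₂₁,
    (mem_SING_iff_forall_det_eq_zero _).mp skewTriple_mem_SING c, zero_mul]

/-- The blow-up certificate `∑ᵢ X'ᵢ ⊗ Tᵢ` of the padded triple (private plumbing).
[cite: MakamWigderson2021, §10.2 (example, p0027)] -/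
private def padCert (k : ℕ) :
    Matrix ((Fin 3 ⊕ Fin k) × Fin 2) ((Fin 3 ⊕ Fin k) × Fin 2) ℂ :=
  ∑ i, Matrix.kroneckerMap (· * ·) (padS k i) (certT i)

/-- The certificate lies in the square `2`-blow-up of the padded space. [folklore] -/
private theorem padCert_mem_blowUp (k : ℕ) :
    padCert k ∈ blowUp (Set.range (padS k)) (Fin 2) (Fin 2) :=
  Submodule.sum_mem _ fun i _ => Submodule.subset_span ⟨padS k i, ⟨i, rfl⟩, certT i, rfl⟩

/-- `certM · certN = 1` (the tree's `6 × 6` certificate for the `𝔰𝔬₃` triple, recomputed here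
because the tree's lemma is private). [cite: MakamWigderson2021, §10.2 (example, p0027)] -/
private theorem certM_mul_certN_eq_one : certM * certN = 1 := by
  ext p q
  rcases p with ⟨i, a⟩
  rcases q with ⟨j, b⟩
  fin_cases i <;> fin_cases a <;> fin_cases j <;> fin_cases b <;>
    simp [certM, certN, certT, skewTriple, Matrix.mul_apply, Fintype.sum_prod_type,
      Fin.sum_univ_three, Fin.sum_univ_two, Matrix.kroneckerMap_apply, finProdFinEquiv,
      Matrix.cons_val_zero, Matrix.cons_val_one, Matrix.cons_val_two, Matrix.head_cons,
      Matrix.tail_cons]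

/-- `T₁² = 1` for the first certificate block `T₁ = diag(1,-1)`. [folklore] -/
private theorem certT_zero_mul_self : certT 0 * certT 0 = 1 := by
  ext a b
  fin_cases a <;> fin_cases b <;>
    simp [certT, Matrix.mul_apply, Fin.sum_univ_two, Matrix.cons_val_zero, Matrix.cons_val_one]

/-- After regrouping indices, the padded certificate is block diagonal:
`certM ⊕ (I_k ⊗ T₁)`. [folklore] -/
private theorem reindex_padCert (k : ℕ) :
    Matrix.reindex (Equiv.sumProdDistrib (Fin 3) (Fin k) (Fin 2))
        (Equiv.sumProdDistrib (Fin 3) (Fin k) (Fin 2)) (padCert k) =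
      Matrix.fromBlocks certM 0 0
        (Matrix.kroneckerMap (· * ·) (1 : Matrix (Fin k) (Fin k) ℂ) (certT 0)) := by
  ext (⟨p, a⟩ | ⟨x, a⟩) (⟨q, b⟩ | ⟨y, b⟩)
  · simp [padCert, padS, certM, Matrix.sum_apply, Matrix.kroneckerMap_apply]
  · simp [padCert, padS, Matrix.sum_apply, Matrix.kroneckerMap_apply]
  · simp [padCert, padS, Matrix.sum_apply, Matrix.kroneckerMap_apply]
  · simp [padCert, padS, Matrix.kroneckerMap_apply, Fin.sum_univ_three]

/-- The padded certificate is invertible. [folklore] -/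
private theorem isUnit_det_padCert (k : ℕ) : IsUnit (padCert k).det := by
  rw [← Matrix.det_reindex_self (Equiv.sumProdDistrib (Fin 3) (Fin k) (Fin 2)), reindex_padCert,
    Matrix.det_fromBlocks_zero₂₁]
  refine IsUnit.mul ?_ ?_
  · have h := congrArg Matrix.det certM_mul_certN_eq_one
    rw [Matrix.det_mul, Matrix.det_one] at h
    exact IsUnit.of_mul_eq_one _ h
  · have h : Matrix.kroneckerMap (· * ·) (1 : Matrix (Fin k) (Fin k) ℂ) (certT 0) *
        Matrix.kroneckerMap (· * ·) (1 : Matrix (Fin k) (Fin k) ℂ) (certT 0) = 1 := by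
      rw [← Matrix.mul_kronecker_mul, Matrix.mul_one, certT_zero_mul_self, Matrix.one_kronecker_one]
    have h' := congrArg Matrix.det h
    rw [Matrix.det_mul, Matrix.det_one] at h'
    exact IsUnit.of_mul_eq_one _ h'

/-- The padded space has full non-commutative rank `3 + k` ([DM18, Cor. 4.7] via the tree's
`ncRank_eq_card_of_mem_blowUp`). [cite: MakamWigderson2021, §10.2 (example, p0027)] -/
private theorem ncRank_range_padS (k : ℕ) :
    ncRank (Set.range (padS k)) = Fintype.card (Fin 3 ⊕ Fin k) := by
  have hunit : IsUnit (padCert k) :=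
    (Matrix.isUnit_iff_isUnit_det _).mpr (isUnit_det_padCert k)
  have hrank : (padCert k).rank = Fintype.card ((Fin 3 ⊕ Fin k) × Fin 2) :=
    Matrix.rank_of_isUnit _ hunit
  refine ncRank_eq_card_of_mem_blowUp (padCert_mem_blowUp k) ?_
  rw [hrank, Fintype.card_prod, mul_comm]

/-- The padded tuple `(S₁ ⊕ I, S₂ ⊕ 0, S₃ ⊕ 0, 0, …, 0) ∈ Mat_{3+k}^{3+l}`, indexed by `Fin`
(private plumbing). [cite: MakamWigderson2021, §10.2 (example, p0027)] -/
private def padTuple (k l : ℕ) : Tuple (3 + k) (3 + l) := fun j =>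
  Sum.elim (fun i => Matrix.reindex finSumFinEquiv finSumFinEquiv (padS k i)) (fun _ => 0)
    (finSumFinEquiv.symm j)

/-- The first three members of the padded tuple. [folklore] -/
private theorem padTuple_inl (k l : ℕ) (i : Fin 3) :
    padTuple k l (finSumFinEquiv (Sum.inl i)) =
      Matrix.reindex finSumFinEquiv finSumFinEquiv (padS k i) := by
  simp only [padTuple, Equiv.symm_apply_apply, Sum.elim_inl]

/-- The remaining members of the padded tuple vanish. [folklore] -/
private theorem padTuple_inr (k l : ℕ) (x : Fin l) :
    padTuple k l (finSumFinEquiv (Sum.inr x)) = 0 := by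
  simp only [padTuple, Equiv.symm_apply_apply, Sum.elim_inr]

/-- The padded tuple lies in `SING_{3+k,3+l}`. [cite: MakamWigderson2021, §10.2 (example, p0027)] -/
private theorem padTuple_mem_SING (k l : ℕ) : padTuple k l ∈ SING (3 + k) (3 + l) := by
  rw [mem_SING_iff_forall_det_eq_zero]
  intro c
  have hsum : ∑ j, c j • padTuple k l j =
      Matrix.reindex finSumFinEquiv finSumFinEquiv
        (∑ i : Fin 3, c (finSumFinEquiv (Sum.inl i)) • padS k i) := by
    rw [← Equiv.sum_comp finSumFinEquiv (fun j => c j • padTuple k l j), Fintype.sum_sum_type]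
    simp only [padTuple_inl, padTuple_inr, smul_zero, Finset.sum_const_zero, add_zero]
    ext a b
    simp only [Matrix.sum_apply, Matrix.smul_apply, Matrix.reindex_apply, Matrix.submatrix_apply]
  rw [hsum, Matrix.det_reindex_self, det_sum_smul_padS]

/-- The padded tuple is not in `NSING_{3+k,3+l}`: its matrix space is the relabelled padded space
(plus zero matrices), of full non-commutative rank.
[cite: MakamWigderson2021, §10.2 (example, p0027)] -/
private theorem padTuple_not_mem_NSING (k l : ℕ) : padTuple k l ∉ NSING (3 + k) (3 + l) := by
  rw [mem_NSING_iff, not_lt]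
  have hspan : Submodule.span ℂ (Set.range (padTuple k l)) =
      Submodule.span ℂ ((Matrix.reindex finSumFinEquiv finSumFinEquiv) '' Set.range (padS k)) := by
    apply le_antisymm
    · rw [Submodule.span_le]
      rintro _ ⟨j, rfl⟩
      obtain ⟨s, rfl⟩ := finSumFinEquiv.surjective j
      rcases s with i | x
      · rw [padTuple_inl]
        exact Submodule.subset_span ⟨padS k i, ⟨i, rfl⟩, rfl⟩
      · rw [padTuple_inr]
        exact Submodule.zero_mem _
    · rw [Submodule.span_le]
      rintro _ ⟨_, ⟨i, rfl⟩, rfl⟩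
      exact Submodule.subset_span ⟨finSumFinEquiv (Sum.inl i), padTuple_inl k l i⟩
  have h1 : ncRank (Set.range (padTuple k l)) = ncRank (Set.range (padS k)) := by
    rw [← ncRank_span, hspan, ncRank_span, ncRank_image_reindex]
  rw [h1, ncRank_range_padS, Fintype.card_sum, Fintype.card_fin, Fintype.card_fin]

/-- **`NSING_{n,m} ⊊ SING_{n,m}` for all `n, m ≥ 3`** (MW §10.2, p0027: the `𝔰𝔬₃` example
"can be modified in straightforward ways" — here padded with an identity block and zero
matrices). [cite: MakamWigderson2021, §10.2 (p0027)] -/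
theorem NSING_ssubset_SING {n m : ℕ} (hn : 3 ≤ n) (hm : 3 ≤ m) : NSING n m ⊂ SING n m := by
  obtain ⟨k, rfl⟩ := Nat.exists_eq_add_of_le hn
  obtain ⟨l, rfl⟩ := Nat.exists_eq_add_of_le hm
  exact Set.ssubset_iff_subset_ne.mpr ⟨NSING_subset_SING, fun h =>
    padTuple_not_mem_NSING k l (h.symm ▸ padTuple_mem_SING k l)⟩

/-! ### Conjunct 1 assembled -/

/-- **`SING_{n,m} = NSING_{n,m}` whenever `n ≤ 2` or `m ≤ 2`** (MW §10.2, p0027, citing [FR], [DM]: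
commutative and non-commutative rank agree for such spaces). [cite: MakamWigderson2021, §10.2 (p0027)] -/
theorem SING_eq_NSING_of_le_two {n m : ℕ} (h : n ≤ 2 ∨ m ≤ 2) : SING n m = NSING n m := by
  rcases Nat.lt_or_ge n 3 with hn | hn
  · -- `n ≤ 2`
    interval_cases n
    · exact SING_eq_NSING_zero m
    · exact SING_eq_NSING_of_subset (SING_one_subset_NSING m)
    · exact SING_eq_NSING_two m
  · have hm : m ≤ 2 := by omega
    interval_cases m
    · exact SING_eq_NSING_of_m_eq_zero n
    · exact SING_eq_NSING_of_subset (SING_subset_NSING_of_m_eq_one n)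
    · exact SING_eq_NSING_of_subset (SING_subset_NSING_of_m_eq_two n)

end MakamWigderson

/-! ### The discharge -/

open MakamWigderson in
/-- **MW 2021, §10.2 — `makamWigderson2021_sec10_properSubset` holds**: "`NSING_{n,m}` is a proper
subset of `SING_{n,m}` precisely when `n, m ≥ 3`": equality for `n ≤ 2` or `m ≤ 2`
(`SING_eq_NSING_of_le_two`), the `𝔰𝔬₃` triple is outside `NSING_{3,3}` (tree,
`skewTriple_not_mem_NSING`), and properness for all `n, m ≥ 3` (`NSING_ssubset_SING`).
[cite: MakamWigderson2021, §10.2 (p0027)] -/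
theorem makamWigderson2021_sec10_properSubset_holds : makamWigderson2021_sec10_properSubset :=
  ⟨fun _ _ h => SING_eq_NSING_of_le_two h, skewTriple_not_mem_NSING,
    fun _ _ hn hm => NSING_ssubset_SING hn hm⟩

namespace MakamWigderson

/-! ### A second certificate with transposed blocks (input of the §11 argument, Thm. 1.16) -/

/-- Regrouped, the transposed-block certificate `∑ᵢ X'ᵢ ⊗ Tᵢᵀ` of the padded triple is block
diagonal `(-certMᵀ) ⊕ (I_k ⊗ T₁ᵀ)` (the `𝔰𝔬₃` blocks are skew-symmetric). [folklore] -/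
private theorem reindex_padCert_transpose (k : ℕ) :
    Matrix.reindex (Equiv.sumProdDistrib (Fin 3) (Fin k) (Fin 2))
        (Equiv.sumProdDistrib (Fin 3) (Fin k) (Fin 2))
        (∑ i, Matrix.kroneckerMap (· * ·) (padS k i) (certT i)ᵀ) =
      Matrix.fromBlocks (-certMᵀ) 0 0
        (Matrix.kroneckerMap (· * ·) (1 : Matrix (Fin k) (Fin k) ℂ) (certT 0)ᵀ) := by
  ext (⟨p, a⟩ | ⟨x, a⟩) (⟨q, b⟩ | ⟨y, b⟩)
  · fin_cases p <;> fin_cases q <;> fin_cases a <;> fin_cases b <;>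
      simp [padS, certM, certT, skewTriple, Matrix.kroneckerMap_apply, Fin.sum_univ_three]
  · simp [padS, Matrix.sum_apply, Matrix.kroneckerMap_apply]
  · simp [padS, Matrix.sum_apply, Matrix.kroneckerMap_apply]
  · simp [padS, Matrix.kroneckerMap_apply, Fin.sum_univ_three]

/-- The transposed-block certificate of the padded triple is invertible. [folklore] -/
private theorem isUnit_det_padCert_transpose (k : ℕ) :
    IsUnit (∑ i, Matrix.kroneckerMap (· * ·) (padS k i) (certT i)ᵀ).det := by
  rw [← Matrix.det_reindex_self (Equiv.sumProdDistrib (Fin 3) (Fin k) (Fin 2)),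
    reindex_padCert_transpose, Matrix.det_fromBlocks_zero₂₁]
  refine IsUnit.mul ?_ ?_
  · rw [Matrix.det_neg, Matrix.det_transpose]
    refine IsUnit.mul (isUnit_one.neg.pow _) ?_
    have h := congrArg Matrix.det certM_mul_certN_eq_one
    rw [Matrix.det_mul, Matrix.det_one] at h
    exact IsUnit.of_mul_eq_one _ h
  · have hT : (certT 0)ᵀ = certT 0 := by
      ext a b
      fin_cases a <;> fin_cases b <;> rfl
    rw [hT]
    have h : Matrix.kroneckerMap (· * ·) (1 : Matrix (Fin k) (Fin k) ℂ) (certT 0) *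
        Matrix.kroneckerMap (· * ·) (1 : Matrix (Fin k) (Fin k) ℂ) (certT 0) = 1 := by
      rw [← Matrix.mul_kronecker_mul, Matrix.mul_one, certT_zero_mul_self, Matrix.one_kronecker_one]
    have h' := congrArg Matrix.det h
    rw [Matrix.det_mul, Matrix.det_one] at h'
    exact IsUnit.of_mul_eq_one _ h'

/-- Blow-up sums of the padded tuple are the relabelled blow-up sums of the padded triple.
[folklore] -/
private theorem sum_kronecker_padTuple (k l : ℕ) (T : Fin 3 → Matrix (Fin 2) (Fin 2) ℂ) :
    ∑ j, Matrix.kroneckerMap (· * ·) (padTuple k l j)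
        (Sum.elim T (fun _ => (0 : Matrix (Fin 2) (Fin 2) ℂ)) (finSumFinEquiv.symm j)) =
      Matrix.reindex (finSumFinEquiv.prodCongr (Equiv.refl (Fin 2)))
        (finSumFinEquiv.prodCongr (Equiv.refl (Fin 2)))
        (∑ i, Matrix.kroneckerMap (· * ·) (padS k i) (T i)) := by
  rw [← Equiv.sum_comp finSumFinEquiv, Fintype.sum_sum_type]
  simp only [padTuple_inl, padTuple_inr, Equiv.symm_apply_apply, Sum.elim_inl, Sum.elim_inr]
  ext ⟨x, a⟩ ⟨y, b⟩
  simp [Matrix.sum_apply, Matrix.kroneckerMap_apply, Matrix.reindex_apply, Matrix.submatrix_apply]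

/-- **A point of `SING_{n,m} ∖ NSING_{n,m}` with an explicit pair of blow-up certificates**
(`n, m ≥ 3`): the padded `𝔰𝔬₃` tuple `X'` and `2 × 2` blocks `T` with both `det(∑ X'ⱼ ⊗ Tⱼ) ≠ 0`
and `det(∑ X'ⱼ ⊗ Tⱼᵀ) ≠ 0` — the input of the §11 argument (Thm. 1.16) that the ring generated by
the `det(∑ cᵢXᵢ)` misses an `SL_n × SL_n`-invariant. [cite: MakamWigderson2021, §10.2 (example, p0027)] -/
theorem exists_mem_SING_det_kronecker_ne_zero {n m : ℕ} (hn : 3 ≤ n) (hm : 3 ≤ m) :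
    ∃ X ∈ SING n m, ∃ T : Fin m → Matrix (Fin 2) (Fin 2) ℂ,
      (∑ j, Matrix.kroneckerMap (· * ·) (X j) (T j)).det ≠ 0 ∧
      (∑ j, Matrix.kroneckerMap (· * ·) (X j) (T j)ᵀ).det ≠ 0 := by
  obtain ⟨k, rfl⟩ := Nat.exists_eq_add_of_le hn
  obtain ⟨l, rfl⟩ := Nat.exists_eq_add_of_le hm
  refine ⟨padTuple k l, padTuple_mem_SING k l,
    fun j => Sum.elim certT (fun _ => (0 : Matrix (Fin 2) (Fin 2) ℂ)) (finSumFinEquiv.symm j),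
    ?_, ?_⟩
  · rw [sum_kronecker_padTuple, Matrix.det_reindex_self]
    exact (isUnit_det_padCert k).ne_zero
  · have hT : ∀ j : Fin (3 + l),
        (Sum.elim certT (fun _ => (0 : Matrix (Fin 2) (Fin 2) ℂ)) (finSumFinEquiv.symm j))ᵀ =
          Sum.elim (fun i => (certT i)ᵀ) (fun _ => (0 : Matrix (Fin 2) (Fin 2) ℂ))
            (finSumFinEquiv.symm j) := by
      intro j
      rcases finSumFinEquiv.symm j with i | x
      · rfl
      · exact Matrix.transpose_zero
    simp_rw [hT]
    rw [sum_kronecker_padTuple, Matrix.det_reindex_self]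
    exact (isUnit_det_padCert_transpose k).ne_zero

end MakamWigderson

end Literature.Computability.AlgebraicComplexity

end
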